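import Summits.CriticalPhenomena.PercolationContinuityZ3.Theorems.SubpolynomialBlocking.Negative.OffCritical
import Literature.Barriers.CriticalPhenomena.SpanningClustersAboveSixProofs

/-!
# `SubpolynomialBlocking` — negative knowledge II: the dimension is load-bearing (`d ≥ 7`, `η = 0`)

Support file for crux item stmt-CriticalPhenomena-4446 (`PercNonProliferation.SubpolynomialBlocking`), written by
the crux's standing disprover (Cruxes/SubpolynomialBlocking/Disproof.lean, §4). With the vocabulary of
`Negative/OffCritical.lean` (`SubpolynomialBlockingAt d p`, `blockProb d p n`; the crux is `d = 3, p = p_c`):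

* `blockProb_le_div` — QUANTITATIVE Aizenman 1997 Thm. 4 for the annulus: in `d = m + 7`, under the two-point
  bounds `TwoPointBoundedRatio d` ((t-c) with `η = 0`), `u_n(d, p_c) ≤ K/n` for `n ≥ 1` (second-moment bound
  `real_numSpanning_ge` of the barrier proof `SpanningClustersAboveSixProofs`, with `ε = n^{-(m+1)}`, then
  `bulkSpanning ⊆ annulusCrossing` in measure). The barrier file only records `P(cross) → 1` without a rate;
* `not_subpolynomialBlockingAt_criticalProb_above_six` — hence for every `d > 6` with `TwoPointBoundedRatio d` the
  `d`-dimensional crux at `p_c(ℤ^d)` is FALSE (`s = 1/2`);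
* `not_subpolynomialBlockingAt_criticalProb_of_hara` — for `d ≥ 11`, modulo the named fact
  `Hara2008_etaZeroXSpace` (Heydenreich–van der Hofstad 2017, Thm. 11.4).

Consequence for provers: any proof of the crux must use an input that fails above six dimensions under `η = 0`
(hyperscaling side), exactly as the barrier `SpanningClustersAboveSix` demands — now also for the sub-polynomial form.
-/

noncomputable section

namespace Summit.CriticalPhenomena.PercolationContinuityZ3.Theorems.SubpolynomialBlocking.Negative

open MeasureTheory Filter Topology
open Literature.Probability.Percolation Literature.Probability.LatticeModels
open Literature.Barriers.CriticalPhenomena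
open Literature.Probability.Percolation.DCT16
open Summit.CriticalPhenomena.PercolationContinuityZ3.Theses

/-! ## §4 Load-bearing: the dimension (`d ≥ 7` with (t-c)/`η = 0` kills the statement with rate `1/n`) -/

/-- **Quantitative Aizenman above six dimensions**: in `d = m + 7`, under the two-point bounds of
`TwoPointBoundedRatio`, the critical annulus is blocked with probability at most `K/n` for `n ≥ 1`
(`real_numSpanning_ge` with `ε = n^{-(m+1)}`: `N_n ≥ 1` with probability `≥ 1 - 2κ n^{-(d-6)}`, then
bulk spanning `⊆` annulus crossing). -/
theorem blockProb_le_div {m : ℕ} (hτ : TwoPointBoundedRatio (m + 7)) :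
    ∃ K : ℝ, 0 ≤ K ∧ ∀ n : ℕ, 1 ≤ n → blockProb (m + 7) (criticalProbI (m + 7)) n ≤ K / n := by
  obtain ⟨C', C, hC', -, hb⟩ := hτ.natPow (by omega)
  have e5 : m + 7 - 2 = m + 5 := by omega
  have hLow : ∀ x y : Site (m + 7), x ≠ y →
      C' * (‖x - y‖ ^ (m + 5))⁻¹ ≤ tau (m + 7) (criticalProbI (m + 7)) x y :=
    fun x y hxy => by have h := (hb x y hxy).1; rwa [e5] at h
  have hUp : ∀ x y : Site (m + 7), x ≠ y →
      tau (m + 7) (criticalProbI (m + 7)) x y ≤ C * (‖x - y‖ ^ (m + 5))⁻¹ :=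
    fun x y hxy => by have h := (hb x y hxy).2; rwa [e5] at h
  have hU := tau_le_rieszWt_of_upper (criticalProbI (m + 7)) hUp
  set κ : ℝ := 4 * spanningDiagConst m (max C 1) / (C' * 2 ^ (m + 7)) ^ 2 with hκ
  have hκ0 : 0 ≤ κ := by
    have : 0 ≤ spanningDiagConst m (max C 1) :=
      spanningDiagConst_nonneg (le_trans zero_le_one (le_max_right _ _))
    positivity
  refine ⟨2 * κ, by positivity, fun n hn => ?_⟩
  have hn0 : (0 : ℝ) < n := by exact_mod_cast hn
  set ε : ℝ := ((n : ℝ) ^ (m + 1))⁻¹ with hε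
  have hε0 : 0 < ε := by positivity
  have key := real_numSpanning_ge (criticalProbI (m + 7)) hC' hLow hU hn hε0
  -- the event `{N_n ≥ ε n^{m+1}} = {N_n ≥ 1}` lies in `bulkSpanning ⊆ annulusCrossing` (in measure)
  have hεn : ε * (n : ℝ) ^ (m + 1) = 1 := by rw [hε, inv_mul_cancel₀ (by positivity)]
  have hsub : {ω : BondConfig (Site (m + 7)) |
      ENNReal.ofReal (ε * (n : ℝ) ^ (m + 1)) ≤ (numSpanningClusters (m + 7) n ω : ENNReal)} ⊆
        bulkSpanning (m + 7) n := fun ω hω =>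
    mem_bulkSpanning_of_ofReal_le (by rw [hεn]; exact one_pos) hω
  have hcross : 1 - κ * (((n : ℝ) ^ (m + 1))⁻¹ + ε) ≤
      (bondPercolation (zdGraph (m + 7)) (criticalProbI (m + 7))).real (annulusCrossing (m + 7) n) :=
    key.trans ((measureReal_mono hsub).trans (real_bulkSpanning_le_real_annulusCrossing _ _ _))
  rw [blockProb_eq]
  have hε' : ((n : ℝ) ^ (m + 1))⁻¹ + ε = 2 * ε := by rw [hε]; ring
  rw [hε'] at hcross
  -- `ε ≤ 1/n`
  have hεle : ε ≤ (n : ℝ)⁻¹ := by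
    rw [hε]
    refine inv_anti₀ hn0 ?_
    calc (n : ℝ) = (n : ℝ) ^ 1 := (pow_one _).symm
      _ ≤ (n : ℝ) ^ (m + 1) := pow_le_pow_right₀ (by exact_mod_cast hn) (by omega)
  calc 1 - (bondPercolation (zdGraph (m + 7)) (criticalProbI (m + 7))).real (annulusCrossing (m + 7) n)
      ≤ κ * (2 * ε) := by linarith
    _ ≤ κ * (2 * (n : ℝ)⁻¹) := by gcongr
    _ = 2 * κ / n := by ring

/-- **The dimension is load-bearing**: for every `d > 6` satisfying Aizenman's hypothesis
`TwoPointBoundedRatio d` ((t-c) with `η = 0`), the `d`-dimensional crux at `p_c(ℤ^d)` is FALSE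
(`s = 1/2`: `n^{-1/2} ≤ u_n ≤ K/n` fails for `n > K²`). Any proof of the crux must therefore use an
input that fails above six dimensions. -/
theorem not_subpolynomialBlockingAt_criticalProb_above_six {d : ℕ} (hd : 6 < d)
    (hτ : TwoPointBoundedRatio d) : ¬ SubpolynomialBlockingAt d (criticalProbI d) := by
  obtain ⟨m, rfl⟩ : ∃ m, d = m + 7 := ⟨d - 7, by omega⟩
  obtain ⟨K, hK, hb⟩ := blockProb_le_div hτ
  intro h
  have h1 := (subpolynomialBlockingAt_iff _ _).1 h (1 / 2) (by norm_num)
  rw [eventually_atTop] at h1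
  obtain ⟨N, hN⟩ := h1
  -- pick `n ≥ N`, `n ≥ 1`, `n > 4 K²`
  set n : ℕ := max N (⌈4 * K ^ 2⌉₊ + 1) with hn
  have hnN : N ≤ n := le_max_left _ _
  have hn1 : 1 ≤ n := le_trans (Nat.succ_le_succ (Nat.zero_le _)) (le_max_right _ _)
  have hn0 : (0 : ℝ) < n := by exact_mod_cast hn1
  have hnK : 4 * K ^ 2 < n := by
    have : (⌈4 * K ^ 2⌉₊ : ℝ) + 1 ≤ n := by rw [hn]; exact_mod_cast le_max_right _ _
    linarith [Nat.le_ceil (4 * K ^ 2)]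
  have hA := (hN n hnN).trans (hb n hn1)
  -- `n^{-1/2} ≤ K / n` means `√n ≤ K`, i.e. `n ≤ K²`
  have hsq : Real.sqrt n ≤ K := by
    have e1 : (n : ℝ) ^ (-(1 / 2 : ℝ)) = (Real.sqrt n)⁻¹ := by
      rw [Real.rpow_neg hn0.le, Real.sqrt_eq_rpow]
    rw [e1] at hA
    have hs0 : 0 < Real.sqrt n := Real.sqrt_pos.2 hn0
    rw [inv_le_iff_one_le_mul₀ hs0] at hA
    -- `1 ≤ K / n * √n = K / √n`
    have : K / n * Real.sqrt n = K / Real.sqrt n := by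
      rw [div_mul_eq_mul_div, div_eq_div_iff hn0.ne' hs0.ne']
      rw [mul_assoc, Real.mul_self_sqrt hn0.le]
    rw [this, le_div_iff₀ hs0, one_mul] at hA
    exact hA
  have hK2 : (n : ℝ) ≤ K ^ 2 := by
    have := pow_le_pow_left₀ (Real.sqrt_nonneg _) hsq 2
    rwa [Real.sq_sqrt hn0.le] at this
  nlinarith

/-- **Unconditionally in the dimension, modulo the named fact `Hara2008_etaZeroXSpace`**
(Heydenreich–van der Hofstad 2017, Thm. 11.4): for `d ≥ 11` the `d`-dimensional crux is false. -/
theorem not_subpolynomialBlockingAt_criticalProb_of_hara (h : Hara2008_etaZeroXSpace) {d : ℕ}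
    (hd : 11 ≤ d) : ¬ SubpolynomialBlockingAt d (criticalProbI d) :=
  not_subpolynomialBlockingAt_criticalProb_above_six (by omega) (h.twoPointBoundedRatio hd)


end Summit.CriticalPhenomena.PercolationContinuityZ3.Theorems.SubpolynomialBlocking.Negative
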